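import Mathlib
import HarnessLib
import Summits.MatrixMultiplication.MatrixMultiplication.Theses.SnSubsetDichotomy
import Literature.Barriers.MatrixMultiplication.NilpotentGroupBarrierGradedCoords
import Literature.Barriers.MatrixMultiplication.UniversalMethodBarrierMatMul
import Literature.Computability.AlgebraicComplexity.GroupAlgebraTensor

/-!
# Sketch — crux-ideate round 1 (ideator 3) for crux `PolynomialSlack`
(route `SnSubsetDichotomy`, item stmt-MatrixMultiplication-8306).

First lemmas of the two idea cards, stated over existing declarations:

* Card `modular-radical-filtration`: `ConcentratedFiltration → ModularSliceRankSaving → PolynomialSlack`.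
* Card `quotient-globalisation-by-pruning`: `KL2023ProductMixingLower → QuotientNonGlobal`, plus the
  programme conjecture `QuotientGlobalisationByPruning` and its assembly with the fact.
-/

set_option linter.dupNamespace false

namespace Summit.MatrixMultiplication.MatrixMultiplication.Cruxes.PolynomialSlack.IdeaSketch

open Literature.Barriers.MatrixMultiplication
open Literature.Computability.AlgebraicComplexity
open Literature.Combinatorics.Additive
open Summit.MatrixMultiplication.MatrixMultiplication.Theses.SnSubsetDichotomy (PolynomialSlack)

/-! ## Card 1 — modular radical filtration ⇒ slice rank ⇒ super-polynomial saving -/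

/-- Super-polynomial slice-rank saving for the multiplication tensor of `𝔽_p[S_n]` (some prime `p`
depending on `n`, in practice `p = 2`): `S(M_{S_n}) ≤ n!·n^{-C}` eventually, for every `C`. -/
def ModularSliceRankSaving : Prop :=
  ∀ C : ℝ, ∃ n₀ : ℕ, ∀ n ≥ n₀, ∃ p : ℕ, p.Prime ∧
    (sliceRank (groupTensor (ZMod p) (Equiv.Perm (Fin n))) : ℝ) * (n : ℝ) ^ C ≤ (n.factorial : ℝ)

/-- FIRST LEMMA (card 1): a slice-rank saving over `𝔽_p` bounds every TPP triple, because
`⟨|S|,|T|,|U|⟩` is a (zero-out) restriction of `M_{S_n}` over ANY field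
(`RealizesTPP.tensorRestrictsTo`), slice rank is restriction-monotone
(`sliceRank_le_of_tensorRestrictsTo`) and `m² ≤ 3·S(⟨m,m,m⟩)`
(`mul_sq_le_three_mul_sliceRank_multiple_matMul` with `F = 1`); with `m = min(|S|,|T|,|U|)` and the
packing bound `|S||T| ≤ n!` this gives `|S||T||U| ≤ m·n! ≤ (3 S)^{1/2} n!`. Provable now. -/
def SliceRankSavingImpliesPolynomialSlack : Prop :=
  ModularSliceRankSaving → PolynomialSlack

/-- THE MECHANISM (card 1): graded coordinates on `𝔽_p[S_n]` (a multiplicative filtration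
`F_a F_b ⊆ F_{a+b}` with an adapted basis — e.g. the radical filtration `J^a` of the non-semisimple
group algebra, `p ≤ n`) whose degree profile is CONCENTRATED: both tails `#{deg < a}` and
`#{deg ≥ 2a}` are `≤ n!·n^{-C}/3` for some threshold `a`. By BCCGU Prop. 3.2 in coordinates
(`GradedCoords.sliceRank_le`) this is `ModularSliceRankSaving`. -/
def ConcentratedFiltration : Prop :=
  ∀ C : ℝ, ∃ n₀ : ℕ, ∀ n ≥ n₀, ∃ (p : ℕ) (_ : Fact p.Prime) (Λ : Type) (_ : Fintype Λ)
    (B : GradedCoords (ZMod p) (Equiv.Perm (Fin n)) Λ) (a : ℕ),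
    ((Fintype.card {i : Λ // B.deg i < a} + Fintype.card {i : Λ // B.deg i < a} +
        Fintype.card {k : Λ // a + a ≤ B.deg k} : ℕ) : ℝ) * (n : ℝ) ^ C ≤ (n.factorial : ℝ)

/-- `ConcentratedFiltration → ModularSliceRankSaving` (BCCGU Prop. 3.2 in coordinates +
`sliceRank_groupTensor`). -/
theorem modularSliceRankSaving_of_concentratedFiltration (h : ConcentratedFiltration) :
    ModularSliceRankSaving := by
  classical
  intro C
  obtain ⟨n₀, hn₀⟩ := h C
  refine ⟨n₀, fun n hn => ?_⟩
  obtain ⟨p, hp, Λ, hΛ, B, a, hB⟩ := hn₀ n hn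
  refine ⟨p, hp.out, le_trans ?_ hB⟩
  have hsr : sliceRank (groupTensor (ZMod p) (Equiv.Perm (Fin n))) ≤
      Fintype.card {i : Λ // B.deg i < a} + Fintype.card {i : Λ // B.deg i < a} +
        Fintype.card {k : Λ // a + a ≤ B.deg k} := by
    rw [sliceRank_groupTensor]
    exact B.sliceRank_le a a
  have hC : (0 : ℝ) ≤ (n : ℝ) ^ C := Real.rpow_nonneg (Nat.cast_nonneg n) C
  exact mul_le_mul_of_nonneg_right (by exact_mod_cast hsr) hC

/-! ## Card 2 — quotient-set globalisation by pruning (Keevash–Lifshitz product mixing) -/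

/-- `r`-globalness of a set `X` of permutations RELATIVE TO A HOST `H ⊇ X` (Keevash–Lifshitz 2023,
Def. 1.6, for indicator functions: restricting to any `t`-umvirate `U_{I→J}` multiplies the density
by at most `r^{2t}`), written multiplicatively with counts so that `H = univ` is globalness in `S_n`
and `H = Stab_pw(L)` is globalness inside `S_{n-|L|}`. -/
def IsGlobalWithin {n : ℕ} (H : Finset (Equiv.Perm (Fin n))) (r : ℝ)
    (X : Finset (Equiv.Perm (Fin n))) : Prop :=
  X ⊆ H ∧ ∀ t : ℕ, ∀ I J : Fin t → Fin n, Function.Injective I → Function.Injective J →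
    ((X.filter (fun σ => ∀ k, σ (I k) = J k)).card : ℝ) * (H.card : ℝ) ≤
      r ^ (2 * t) * (X.card : ℝ) * ((H.filter (fun σ => ∀ k, σ (I k) = J k)).card : ℝ)

/-- `r`-globalness in `S_n` (host = everything): `|X ∩ U_{I→J}|·n^{(t)} ≤ r^{2t}|X|`. -/
def IsGlobal {n : ℕ} (r : ℝ) (X : Finset (Equiv.Perm (Fin n))) : Prop :=
  IsGlobalWithin Finset.univ r X

/-- NAMED FACT used as hypothesis (Keevash–Lifshitz, arXiv:2307.15030, Thm. 1.14, lower half, for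
even permutations; paraphrase): for some absolute `c > 0` and all large `n`, if `A, B, C ⊆ A_n` are
`100`-global with densities `≥ e^{-c n^{1/3}}` in `A_n`, then
`#{(a,b) ∈ A × B : ab ∈ C} ≥ 0.99·|A||B||C|/|A_n|`. Unproved here (Literature fact to vendor). -/
def KL2023ProductMixingLower : Prop :=
  ∃ c : ℝ, 0 < c ∧ ∃ n₀ : ℕ, ∀ n ≥ n₀, ∀ A B C : Finset (Equiv.Perm (Fin n)),
    (∀ σ ∈ A, Equiv.Perm.sign σ = 1) → (∀ σ ∈ B, Equiv.Perm.sign σ = 1) →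
    (∀ σ ∈ C, Equiv.Perm.sign σ = 1) →
    IsGlobal 100 A → IsGlobal 100 B → IsGlobal 100 C →
    Real.exp (-(c * (n : ℝ) ^ ((1 : ℝ) / 3))) * ((n.factorial : ℝ) / 2) ≤ (A.card : ℝ) →
    Real.exp (-(c * (n : ℝ) ^ ((1 : ℝ) / 3))) * ((n.factorial : ℝ) / 2) ≤ (B.card : ℝ) →
    Real.exp (-(c * (n : ℝ) ^ ((1 : ℝ) / 3))) * ((n.factorial : ℝ) / 2) ≤ (C.card : ℝ) →
    0.99 * ((A.card : ℝ) * (B.card : ℝ) * (C.card : ℝ)) / ((n.factorial : ℝ) / 2) ≤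
      (((A ×ˢ B).filter (fun ab => ab.1 * ab.2 ∈ C)).card : ℝ)

/-- FIRST LEMMA (card 2), conclusion: under polynomial slack the three QUOTIENT sets
`S⁻¹T, T⁻¹U, S⁻¹U` of an even TPP triple cannot all be `100`-global. (From the fact: they are
full-size — `|S⁻¹T| = |S||T| ≥ n!·n^{-2C}`, so `e^{-cn^{1/3}}`-dense — and by the TPP the count
`#{(a,b) ∈ S⁻¹T × T⁻¹U : ab ∈ S⁻¹U}` is EXACTLY `|S||T||U| =: N`, whereas mixing demands
`≥ 0.99 N²/(n!/2) ≫ N`.) -/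
def QuotientNonGlobal : Prop :=
  ∀ C : ℝ, ∃ n₀ : ℕ, ∀ n ≥ n₀, ∀ S T U : Finset (Equiv.Perm (Fin n)),
    (∀ σ ∈ S, Equiv.Perm.sign σ = 1) → (∀ σ ∈ T, Equiv.Perm.sign σ = 1) →
    (∀ σ ∈ U, Equiv.Perm.sign σ = 1) →
    TripleProductProperty S T U →
    (n.factorial : ℝ) ^ ((3 : ℝ) / 2) ≤ ((S.card * T.card * U.card : ℕ) : ℝ) * (n : ℝ) ^ C →
    ¬ (IsGlobal 100 (Finset.image₂ (fun s t => s⁻¹ * t) S T) ∧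
        IsGlobal 100 (Finset.image₂ (fun t u => t⁻¹ * u) T U) ∧
        IsGlobal 100 (Finset.image₂ (fun s u => s⁻¹ * u) S U))

/-- FIRST LEMMA (card 2): the Keevash–Lifshitz fact gives `QuotientNonGlobal`. Provable now. -/
def QuotientNonGlobalOfMixing : Prop :=
  KL2023ProductMixingLower → QuotientNonGlobal

/-- The exact count behind the first lemma (pure combinatorics, provable now; dense form of the
route's `QuotientSetDeficit`): for a TPP triple the solutions of `ab = c'` in
`S⁻¹T × T⁻¹U × S⁻¹U` are exactly the `|S||T||U|` trivial ones `(s⁻¹t)(t⁻¹u) = s⁻¹u`, and this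
persists for ARBITRARY sub-triples `S' ⊆ S, T' ⊆ T, U' ⊆ U` (pruning is free). -/
def TrivialSolutionCount : Prop :=
  ∀ (n : ℕ) (S T U : Finset (Equiv.Perm (Fin n))), TripleProductProperty S T U →
    ((Finset.image₂ (fun s t => s⁻¹ * t) S T ×ˢ Finset.image₂ (fun t u => t⁻¹ * u) T U).filter
        (fun ab => ab.1 * ab.2 ∈ Finset.image₂ (fun s u => s⁻¹ * u) S U)).card =
      S.card * T.card * U.card

/-- The pointwise stabiliser of a tuple `L`, as a Finset (host `≅ S_{n-t}` after descent). -/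
def stabFinset {n t : ℕ} (L : Fin t → Fin n) : Finset (Equiv.Perm (Fin n)) :=
  Finset.univ.filter (fun σ => ∀ k, σ (L k) = L k)

/-- THE PROGRAMME CONJECTURE (card 2, the hard part): globalisation by pruning and common descent.
Under polynomial slack one can prune `S, T, U` to sub-sets (losing at most a factor
`e^{n^{1/3}/K}` each — affordable, since pruning never changes the non-mixing ratio `n!/N` by more
than that), right-translate them, and descend to a common pointwise stabiliser `Stab(L)`,
`|L| ≤ K log n`, so that the three quotient sets become `100`-global INSIDE `Stab(L)`. Together
with `TrivialSolutionCount` and `KL2023ProductMixingLower` (applied in `Stab(L) ≅ S_{n-|L|}`)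
this contradicts the TPP, proving `PolynomialSlack` (indeed slack `e^{-c n^{1/3}}`). -/
def QuotientGlobalisationByPruning : Prop :=
  ∀ C : ℝ, ∃ n₀ K : ℕ, ∀ n ≥ n₀, ∀ S T U : Finset (Equiv.Perm (Fin n)),
    TripleProductProperty S T U →
    (n.factorial : ℝ) ^ ((3 : ℝ) / 2) ≤ ((S.card * T.card * U.card : ℕ) : ℝ) * (n : ℝ) ^ C →
    ∃ (t : ℕ) (L : Fin t → Fin n), Function.Injective L ∧ (t : ℝ) ≤ K * Real.log n ∧
    ∃ (S' T' U' : Finset (Equiv.Perm (Fin n))) (α β γ : Equiv.Perm (Fin n)),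
      S'.image (· * α) ⊆ S ∧ T'.image (· * β) ⊆ T ∧ U'.image (· * γ) ⊆ U ∧
      S' ⊆ stabFinset L ∧ T' ⊆ stabFinset L ∧ U' ⊆ stabFinset L ∧
      (∀ σ ∈ S', Equiv.Perm.sign σ = 1) ∧ (∀ σ ∈ T', Equiv.Perm.sign σ = 1) ∧
      (∀ σ ∈ U', Equiv.Perm.sign σ = 1) ∧
      Real.exp (-((n : ℝ) ^ ((1 : ℝ) / 3) / K)) * (S.card : ℝ) ≤ (S'.card : ℝ) ∧
      Real.exp (-((n : ℝ) ^ ((1 : ℝ) / 3) / K)) * (T.card : ℝ) ≤ (T'.card : ℝ) ∧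
      Real.exp (-((n : ℝ) ^ ((1 : ℝ) / 3) / K)) * (U.card : ℝ) ≤ (U'.card : ℝ) ∧
      IsGlobalWithin (stabFinset L) 100 (Finset.image₂ (fun s t => s⁻¹ * t) S' T') ∧
      IsGlobalWithin (stabFinset L) 100 (Finset.image₂ (fun t u => t⁻¹ * u) T' U') ∧
      IsGlobalWithin (stabFinset L) 100 (Finset.image₂ (fun s u => s⁻¹ * u) S' U')

/-- Assembly of card 2 (how the line concludes the crux BY NAME). -/
def Card2Assembly : Prop :=
  KL2023ProductMixingLower → QuotientGlobalisationByPruning → PolynomialSlack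


/-! ## Card 3 — transport inequality + random split: reduce to a product-free HULL theorem for A_n -/

/-- Exact (tripartite) product-freeness: no `x ∈ X`, `y ∈ Y` with `xy ∈ Z`. -/
def IsProductFree {n : ℕ} (X Y Z : Finset (Equiv.Perm (Fin n))) : Prop :=
  ∀ x ∈ X, ∀ y ∈ Y, x * y ∉ Z

/-- FIRST LEMMA (card 3a), provable now: the TRANSPORT INEQUALITY. For a TPP triple the `|S||T||U|`
trivial solutions `(s⁻¹t)(t⁻¹u) = s⁻¹u` form a coupling of the uniform measures on the quotient
sets `A = S⁻¹T`, `B = T⁻¹U`, `C′ = S⁻¹U` supported on solutions of `ab = c′`; hence every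
product-free `(X, Y, Z)` misses at least one coordinate of each trivial solution, and
`μ_A(X) + μ_B(Y) + μ_{C′}(Z) ≤ 2` (denominators cleared; `|A| = |S||T|` etc. by the TPP). -/
def TransportInequality : Prop :=
  ∀ (n : ℕ) (S T U : Finset (Equiv.Perm (Fin n))), TripleProductProperty S T U →
    ∀ X Y Z : Finset (Equiv.Perm (Fin n)), IsProductFree X Y Z →
      (Finset.image₂ (fun s t => s⁻¹ * t) S T ∩ X).card * U.card +
        (Finset.image₂ (fun t u => t⁻¹ * u) T U ∩ Y).card * S.card +
        (Finset.image₂ (fun s u => s⁻¹ * u) S U ∩ Z).card * T.card ≤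
      2 * (S.card * T.card * U.card)

/-- FIRST LEMMA (card 3b), provable now: SPLITTING `T` HIDES THE TRIVIAL SOLUTIONS. For disjoint
`T₁, T₂ ⊆ T` the triple `(S⁻¹T₁, T₂⁻¹U, S⁻¹U)` is EXACTLY product-free (a product
`(s⁻¹t₁)(t₂⁻¹u) ∈ S⁻¹U` with `t₁ ≠ t₂` would be a non-trivial TPP solution). -/
def SplitProductFree : Prop :=
  ∀ (n : ℕ) (S T U T₁ T₂ : Finset (Equiv.Perm (Fin n))), TripleProductProperty S T U →
    T₁ ⊆ T → T₂ ⊆ T → Disjoint T₁ T₂ →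
    IsProductFree (Finset.image₂ (fun s t => s⁻¹ * t) S T₁) (Finset.image₂ (fun t u => t⁻¹ * u) T₂ U)
      (Finset.image₂ (fun s u => s⁻¹ * u) S U)

/-- THE CONJECTURE (card 3): PRODUCT-FREE HULLS. Exactly product-free triples of even permutations
of densities `≥ n^{-C}` are `90%`-captured by a product-free triple from a FIXED family `𝓗_n` of
description size `log |𝓗_n| ≤ (n!)^{1/2}·n^{-(C+1)}` ("umvirate/junta configurations are the only
product-free dense configurations", in container form; the generic hypergraph-container count for
the multiplication hypergraph is `(n!)^{1/2}·n log n`, so the density hypothesis must buy the factor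
`n^{C+2} log n`). With `SplitProductFree`, Hoeffding over a uniformly random half `T₁` of the largest
factor (`|T| ≥ (n!)^{1/2} n^{-C/3}`) and a union bound over `𝓗_n`, the hull of
`(S⁻¹T₁, T₂⁻¹U, S⁻¹U)` captures `≈ 90%` of ALL of `A` and `B` by exchangeability, and
`TransportInequality` gives `0.9 + 0.9 + 0.9 ≤ 2 + o(1)` — absurd: `PolynomialSlack`. -/
def ProductFreeHull : Prop :=
  ∀ C : ℝ, ∃ n₀ : ℕ, ∀ n ≥ n₀,
    ∃ 𝓗 : Finset (Finset (Equiv.Perm (Fin n)) × Finset (Equiv.Perm (Fin n)) ×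
        Finset (Equiv.Perm (Fin n))),
      Real.log (𝓗.card : ℝ) ≤ (n.factorial : ℝ) ^ ((1 : ℝ) / 2) * (n : ℝ) ^ (-(C + 1)) ∧
      (∀ H ∈ 𝓗, IsProductFree H.1 H.2.1 H.2.2) ∧
      ∀ X Y Z : Finset (Equiv.Perm (Fin n)),
        (∀ σ ∈ X, Equiv.Perm.sign σ = 1) → (∀ σ ∈ Y, Equiv.Perm.sign σ = 1) →
        (∀ σ ∈ Z, Equiv.Perm.sign σ = 1) →
        (n.factorial : ℝ) * (n : ℝ) ^ (-C) ≤ (X.card : ℝ) →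
        (n.factorial : ℝ) * (n : ℝ) ^ (-C) ≤ (Y.card : ℝ) →
        (n.factorial : ℝ) * (n : ℝ) ^ (-C) ≤ (Z.card : ℝ) →
        IsProductFree X Y Z →
        ∃ H ∈ 𝓗, 9 * X.card ≤ 10 * (X ∩ H.1).card ∧ 9 * Y.card ≤ 10 * (Y ∩ H.2.1).card ∧
          9 * Z.card ≤ 10 * (Z ∩ H.2.2).card

/-- Assembly of card 3 (concludes the crux BY NAME). -/
def Card3Assembly : Prop :=
  ProductFreeHull → PolynomialSlack

end Summit.MatrixMultiplication.MatrixMultiplication.Cruxes.PolynomialSlack.IdeaSketch
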